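import Summits.QuantumFields.BalabanUV.Beta.GAN24.LegTowerWindowSources
import Summits.QuantumFields.BalabanUV.Beta.GAN24.LegTowerWindowDriftSources
import Summits.QuantumFields.BalabanUV.Beta.CombChartHColumnWard
import Summits.QuantumFields.BalabanUV.Beta.CombChartWardSockets

/-!
# `BalabanUV.Beta.GAN24.CombLegTowerWindowSources` — binder row G-an2-4 ∕ (CONV-C), TRANSFER-III (the (α-0) chain at row D1's literal of record (III′)),
# row L11 (Q-L), CONSUMER SIDE: **THE (Q-L) SHAPE ∕ DRIFT ENDS FOR A COMB-CHART LEG TOWER — THE (III′) TWINS OF MY (E) FILES `LegTowerWindowSources` §3 AND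
# `LegTowerWindowDriftSources` §3** (legs `G′♮_m := unitK (sfStep Lc m) (smStep d Lc m) (GcombSh Lc m)`, an2's comb-chart step resolvent of `JsB12CombShSym`, instead
# of `K♮ᴱ_m := unitK_m (coDressKBmAt ρ Lc (KInvStep Lc m))`; NO root `r`: `G′_j` is rooted at the block centre by construction)
# (G-an2-4 CRUX TEAM (2), leaf prover `b2b-balaban-gan24-formalise-leaf-03`, gen 81; FILE W1 of the journal INTENT [LEAF03-G81-INTENT-1]; the OWNER gan24-p1 g46's
# (III′) link table R-gan24p1-g46-2, row «L11–L13 (Q-L) windows … first refusal = the (E) authors file by file»; no existing file touched)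

NOT IN PRINT; OUR BOOKKEEPING ([folklore] window bookkeeping BY NAME; the §1–§2 statements are the (E) files' §3 with `coDressKBmAt (toSite r) Lc (KInvStep Lc m) ↦
GcombSh Lc m` and the root binder `hr` dropped; proofs token for token over MY generic (E) §2 sockets `good_rdiv_tower_of_windows_slaved_mem{,₀}` ∕
`good_rdiv_towerDiff_of_windows_slaved_mem` and g60's `rdiv_lin4_affine`, whose two Ward inputs at the comb-chart legs are an2's `colH_ward_GcombSh` (in leg units: the
statement of leaf-01 g80's `CombHalfMemberSlavedDivergence.hH_unitK_GcombSh`, re-run locally) and §0's `hM_unitK_GcombSh`; 0 `def`, 0 cited facts, 0 `def … : Prop`, 0 sorry).  HONEST FRAMING (cell contract, verbatim): «discharging `BetaPertH` makes Bałaban's UV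
stability UNCONDITIONAL — a real constructive-QFT result; it is NOT the continuum limit and NOT the Clay problem.»  HONEST DEPENDENCY (verbatim): «continuum YM on T⁴ ⇐
BetaPertH ∧ nine spine estimates (0/9 proved); BetaPertH ⇐ (D1) ∧ (D4) ∧ CAP+tail; G-an2-4 gates asym, D1 and NE2/3/4.»

WHY (context only; asserted nowhere below).  Row L11 of the (α-0) chain reads the four leg-letter rows `hL₁ hL₂ hL₁′ hL₂′` of the tower's `ε`-member from WINDOWS on the
leg chains (MY (E) `LegRowsOfWindows`); at (III′) the `T₂` tower is the comb-chart tower `T2RecOf d Lc (GcombSh Lc) (SpureCombOf tabs …) tabs.M …` whose one-step map is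
`lin4 c₄ G′♮_j Lc` (the OWNER's T5 `CombT2DriftEvenEnd.halfMember_comb_succ_eq`), so its leg letters run on the chains `legChain kc (fun m ↦ G′♮_m) Lc n k`.  MY (E) §2
sockets are generic in the legs `K : ℕ → MKer`; only the (E) §3 instances fix `K♮ᴱ`.  This file types the §3 instances at `G′♮` — the window rows (H1♮), (H1w), (HwD), (H1Δw)
are DISPLAYED on these comb-chart chains (their discharge is the OWNER g47's comb LEG dictionary `CombLegChainGauge` and its successor words, NOT this file).

CONTENT (generic `d`, `Lc ≥ 1` via `[NeZero Lc]`; `T F : ℕ → …` any tower ∕ sources with `T (m+1) = lin4 (c m) G′♮_m Lc (T m) + F m`, `T 0` and every `F m` bounded).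
* §0 plumbing: `rowM_ward_GcombSh` (an2's `rowM_ward_of_packed` at `colM_GcombSh_ward` ∕ `GcombSh_inr_inr_off` — the twin of an1's `rowM_ward_coDressKBmAt_KInvStep`),
  **`hM_unitK_GcombSh`** (the twin of MY g58 `Lin4LegDivergence.hM_unitK_comb`), `decays_unitK_GcombSh`.
* §1 **`locStencil₂_rdiv_tower_of_windows_slaved_combChart_mem`** ((H1♮ on `P`)_δ ∧ (H1w on `P`)_{δS→δ} ∧ (HS)_{δS} ∧ (HSL) ∧ (H0)_δ ∧ (H3) ⟹ `∀ n, LocStencil₂ (rdiv ∘ T n)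
  (M + (Cg·σ + k₀·(A·C_F + B·g_F))·(1 − θ)⁻¹) δ`) and the display of record **`…_combChart_mem₀`** ((H0) replaced by the initial member's rows (Hx0)_{δS} ∕ (HxL0)).
* §2 **`locStencil₂_rdiv_towerDiff_of_windows_slaved_combChart_mem`** (the drift END at three rates `δ`, `δS`, `δD`: `∃ c′ ϑ, 0 ≤ c′ ∧ 0 < ϑ < 1 ∧ ∀ n, LocStencil₂ (rdiv ∘ T (n+1)
  − rdiv ∘ T n) (c′·ϑ^n) δD`).
DISPLAYED, NOT discharged: every window row, the source rows, the memberships `hxP hFP hDP hKP hSP`, (H3)∕(H3d).  Asserts NO bound on any chain; discharges NOTHING of (Q-L) ∕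
(C) ∕ «T2Shape» ∕ «T2Drift» ∕ (hW, hWall); the (III′) campaign is NOT asked (an2 W-4); NEVER «G-an2-4 closed» as (CONV-C); NOT D1, NOT `BetaPertH`, NOT continuum, NOT Clay;
not in print.  Unit `b2b-balaban-gan24-formalise-leaf-03` (gen 81), 2026-08-25.
-/

noncomputable section
open Finset
open scoped BigOperators
open Literature.MathematicalPhysics.QuantumFieldTheory
open Literature.MathematicalPhysics.QuantumFieldTheory.Balaban1983to89
open Literature.MathematicalPhysics.QuantumFieldTheory.Balaban1983to89.Beta
open ExpKernelCalculus (MKer Site Decays shiftK)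
open OneStepResolventKernel (Fib)
open OneStepKernelFamily (colH KInvStep)
open B6BondElimination (unitVec)
open AffineAveraging (box toSite)
open BalabanCompositeJets (LocStencil₂)
open Summit.QuantumFields.BalabanUV.Beta.KernelWardRelative (gaugeWt)
open Summit.QuantumFields.BalabanUV.Beta.KernelWardResponse (rowM_ward_of_packed)
open Summit.QuantumFields.BalabanUV.Beta.BorderedHessian (stepScale)
open Summit.QuantumFields.BalabanUV.Beta.HessKerDressedUnits (unitK unitK_apply legScale_inr colH_unitK decays_unitK)
open Summit.QuantumFields.BalabanUV.Beta.AxialDressingRooted (one_le_of_neZero)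
open Summit.QuantumFields.BalabanUV.Beta.CombChartStepJets (GcombSh decays_GcombSh shiftK_GcombSh)
open Summit.QuantumFields.BalabanUV.Beta.CombChartWardSockets (colM_GcombSh_ward GcombSh_inr_inr_off)
open Summit.QuantumFields.BalabanUV.Beta.CombChartHColumnWard (colH_ward_GcombSh)
open Summit.QuantumFields.BalabanUV.Beta.GAN24.CombesThomas (sfStep smStep)
open Summit.QuantumFields.BalabanUV.Beta.GAN24.T2RecursionAffine (lin4)
open Summit.QuantumFields.BalabanUV.Beta.GAN24.Lin4LegTower (rdiv bsum legStep rdiv_lin4_affine)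
open Summit.QuantumFields.BalabanUV.Beta.GAN24.Lin4LegTowerUnroll (legStepB bsumPow legChain)
open Summit.QuantumFields.BalabanUV.Beta.GAN24.T2UnitSplitLevels (bdd₄_add)
open Summit.QuantumFields.BalabanUV.Beta.GAN24.WSlotT2OfPieces (locStencil₂_zero locStencil₂_add locStencil₂_mono)
open Summit.QuantumFields.BalabanUV.Beta.GAN24.LegTowerWindowSources (good_rdiv_tower_of_windows_slaved_mem good_rdiv_tower_of_windows_slaved_mem₀)
open Summit.QuantumFields.BalabanUV.Beta.GAN24.LegTowerWindowDriftSources (good_rdiv_towerDiff_of_windows_slaved_mem)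
open Summit.QuantumFields.BalabanUV.Beta.GAN24.Lin4SlotDivergence (sfStep_mul_smStep)

namespace Summit.QuantumFields.BalabanUV.Beta.GAN24.CombLegTowerWindowSources

variable {d : ℕ} {Lc : ℕ} [NeZero Lc]

/-! ## §0 Plumbing: the multiplier-row Ward law and the decay of the comb-chart unit step kernel -/

/-- [folklore] **(hM♯) FOR THE COMB-CHART STEP RESOLVENT `G′_j`** (an2's `rowM_ward_of_packed` at the multiplier-column Ward law `colM_GcombSh_ward` and the off-lattice
vanishing `GcombSh_inr_inr_off`): `Σ_μ (G′_j x₂ (Lc•(y − e_μ)) (inr ρ) (inr μ) − G′_j x₂ (Lc•y) (inr ρ) (inr μ)) = 0` — the twin of an1's `rowM_ward_coDressKBmAt_KInvStep`. -/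
theorem rowM_ward_GcombSh (j : ℕ) (y x₂ : Site (d + 1)) (ρ' : Fin (d + 1)) :
    ∑ μ, (GcombSh (d := d) Lc j x₂ ((Lc : ℤ) • (y - unitVec μ)) (Sum.inr ρ') (Sum.inr μ)
        - GcombSh (d := d) Lc j x₂ ((Lc : ℤ) • y) (Sum.inr ρ') (Sum.inr μ)) = 0 :=
  rowM_ward_of_packed (colM_GcombSh_ward (d := d) (Lc := Lc) j) (fun x hx z ρ μ => GcombSh_inr_inr_off (d := d) (Lc := Lc) j x hx z ρ μ) y x₂ ρ'

/-- [folklore] **(hM♯) FOR THE NORMALISED COMB-CHART STEP RESOLVENT `G′♮_j := unitK (sfStep Lc j) (smStep d Lc j) (GcombSh Lc j)`** (the units multiply a zero):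
`Σ_μ (G′♮_j x₂ (Lc•(y − e_μ)) (inr ρ) (inr μ) − G′♮_j x₂ (Lc•y) (inr ρ) (inr μ)) = 0` — the twin of MY g58 `Lin4LegDivergence.hM_unitK_comb`. -/
theorem hM_unitK_GcombSh (j : ℕ) (y x₂ : Site (d + 1)) (ρ' : Fin (d + 1)) :
    ∑ μ, (unitK (sfStep Lc j) (smStep d Lc j) (GcombSh (d := d) Lc j) x₂ ((Lc : ℤ) • (y - unitVec μ)) (Sum.inr ρ') (Sum.inr μ)
        - unitK (sfStep Lc j) (smStep d Lc j) (GcombSh (d := d) Lc j) x₂ ((Lc : ℤ) • y) (Sum.inr ρ') (Sum.inr μ)) = 0 := by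
  simp only [unitK_apply, legScale_inr]
  have h := rowM_ward_GcombSh (d := d) (Lc := Lc) j y x₂ ρ'
  have e : ∀ μ : Fin (d + 1), smStep d Lc j * GcombSh (d := d) Lc j x₂ ((Lc : ℤ) • (y - unitVec μ)) (Sum.inr ρ') (Sum.inr μ) * smStep d Lc j
      - smStep d Lc j * GcombSh (d := d) Lc j x₂ ((Lc : ℤ) • y) (Sum.inr ρ') (Sum.inr μ) * smStep d Lc j
      = (smStep d Lc j * smStep d Lc j) * (GcombSh (d := d) Lc j x₂ ((Lc : ℤ) • (y - unitVec μ)) (Sum.inr ρ') (Sum.inr μ)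
          - GcombSh (d := d) Lc j x₂ ((Lc : ℤ) • y) (Sum.inr ρ') (Sum.inr μ)) := fun μ => by ring
  simp only [e, ← Finset.mul_sum, h, mul_zero]

/-- [folklore] Every normalised comb-chart step kernel `G′♮_m` decays at a positive rate (an2's `decays_GcombSh` ⨾ asym1's `decays_unitK`). -/
theorem decays_unitK_GcombSh (m : ℕ) : ∃ δ C : ℝ, 0 < δ ∧ Decays (unitK (sfStep Lc m) (smStep d Lc m) (GcombSh (d := d) Lc m)) C δ := by
  obtain ⟨δK, CK, hδK, -, hG⟩ := decays_GcombSh (d := d) Lc m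
  exact ⟨δK, _, hδK, decays_unitK hG⟩

/-- [folklore] The normalised comb-chart step kernel is `Lc`-block covariant (an2's `shiftK_GcombSh`; the units are constant diagonal factors). -/
theorem shiftK_unitK_GcombSh (j : ℕ) (t : Fin (d + 1) → ℤ) :
    shiftK (-((Lc : ℤ) • t)) (unitK (sfStep Lc j) (smStep d Lc j) (GcombSh (d := d) Lc j))
      = unitK (sfStep Lc j) (smStep d Lc j) (GcombSh (d := d) Lc j) := by
  show unitK (sfStep Lc j) (smStep d Lc j) (shiftK (-((Lc : ℤ) • t)) (GcombSh (d := d) Lc j)) = _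
  rw [shiftK_GcombSh]

/-- [folklore] **(REP-leg) AT THE COMB-CHART LEGS**: for a bounded table `T`, any `c`, any sources `F`,
`rdiv ((lin4 c G′♮_m Lc T + F) s) = legStep (−(c·(Lc^{d+1})⁻¹)) G′♮_m G′♮_m Lc (fun s ↦ bsum Lc (rdiv (T s))) s + rdiv (F s)` (g60's `rdiv_lin4_affine` at `decays_unitK_GcombSh`,
the ℋ-column Ward law of `G′♮_m` (an2's `colH_ward_GcombSh` in leg units) and `hM_unitK_GcombSh`). -/
theorem rdiv_lin4_affine_GcombSh (m : ℕ) (c : ℝ) {T : Fin (d + 1) → (Fin (d + 1) → ℤ) → Fin (d + 1) → (Fin (d + 1) → ℤ) → MKer (d + 1) (Fib d)} {B : ℝ}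
    (hT : ∀ κ u κ' u' x z a b, |T κ u κ' u' x z a b| ≤ B) (F : Fin (d + 1) → (Fin (d + 1) → ℤ) → Fin (d + 1) → (Fin (d + 1) → ℤ) → MKer (d + 1) (Fib d))
    (κ : Fin (d + 1)) (u : Site (d + 1)) (κ' : Fin (d + 1)) (u' : Site (d + 1)) :
    rdiv ((lin4 c (unitK (sfStep Lc m) (smStep d Lc m) (GcombSh (d := d) Lc m)) Lc T + F) κ u κ' u')
      = legStep (-(c * ((Lc : ℝ) ^ (d + 1))⁻¹)) (unitK (sfStep Lc m) (smStep d Lc m) (GcombSh (d := d) Lc m))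
          (unitK (sfStep Lc m) (smStep d Lc m) (GcombSh (d := d) Lc m)) Lc (fun κ u κ' u' => bsum Lc (rdiv (T κ u κ' u'))) κ u κ' u' + rdiv (F κ u κ' u') := by
  obtain ⟨δ', C', hδ', hKm⟩ := decays_unitK_GcombSh (d := d) (Lc := Lc) m
  -- (hH) for `G′♮_m`, `m`-free constant `(Lc^{d+1})⁻¹`: an2's `colH_ward_GcombSh` × asym1's `colH_unitK` (the statement of leaf-01 g80's
  -- `CombHalfMemberSlavedDivergence.hH_unitK_GcombSh`, re-run as a local device — that module has no farm olean at filing time)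
  have hs : stepScale d Lc m ≠ 0 := by
    simp only [stepScale]
    exact pow_ne_zero _ (pow_ne_zero _ (Nat.cast_ne_zero.2 (NeZero.ne Lc)))
  have hH : ∀ (y : Fin (d + 1) → ℤ) (κ' : Fin (d + 1)) (u : Fin (d + 1) → ℤ),
      ∑ μ, (colH (unitK (sfStep Lc m) (smStep d Lc m) (GcombSh (d := d) Lc m)) Lc μ (y - unitVec μ) κ' u
          - colH (unitK (sfStep Lc m) (smStep d Lc m) (GcombSh (d := d) Lc m)) Lc μ y κ' u)
        = ((Lc : ℝ) ^ (d + 1))⁻¹ * gaugeWt Lc y κ' u := by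
    intro y κ' u
    simp only [colH_unitK, Pi.smul_apply, smul_eq_mul, ← mul_sub, ← Finset.mul_sum]
    rw [colH_ward_GcombSh (d := d) (Lc := Lc) m y κ' u, sfStep_mul_smStep, mul_inv, ← mul_assoc, ← mul_assoc, mul_inv_cancel₀ hs, one_mul]
  exact rdiv_lin4_affine hKm hδ' (one_le_of_neZero Lc) c hT hH (hM_unitK_GcombSh m) F κ u κ' u'

/-! ## §1 The comb-chart leg tower, `LocStencil₂` currency, from the affine recursion: the shape END with (H2) discharged -/

section Comb

/-- NOT IN PRINT; OUR BOOKKEEPING.  **THE (Q-L) END FOR A COMB-CHART LEG TOWER, `LocStencil₂` CURRENCY, DIRECT MEMBERSHIP, WITH (H2) DISCHARGED**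
(`T (m+1) = lin4 (c m) G′♮_m Lc (T m) + F m`, `G′♮_m = unitK (sfStep Lc m) (smStep d Lc m) (GcombSh Lc m)`, `kc m = −(c m·(Lc^{d+1})⁻¹)`; `T 0` and the sources bounded;
every member bounded by leaf-01's `lin4_bdd`, the closed one-step law by §0 `rdiv_lin4_affine_GcombSh`): `hxP` ∧ `hFP` ∧ (H1♮ on `P`)_δ ∧ (H1w on `P`)_{δ_S → δ} ∧ (HS)_{δ_S} ∧
(HSL) ∧ (H0)_δ ∧ (H3) ⟹ `∀ n, LocStencil₂ (rdiv ∘ T n) (M + (Cg·σ + k₀·(A·C_F + B·g_F))·(1 − θ)⁻¹) δ` — ONE constant, EVERY level.  The twin of MY (E)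
`LegTowerWindowSources.locStencil₂_rdiv_tower_of_windows_slaved_comb_mem`; the rows are DISPLAYED, not discharged. -/
theorem locStencil₂_rdiv_tower_of_windows_slaved_combChart_mem (c : ℕ → ℝ)
    {T F : ℕ → (Fin (d + 1) → (Fin (d + 1) → ℤ) → Fin (d + 1) → (Fin (d + 1) → ℤ) → MKer (d + 1) (Fib d))}
    (hT0 : ∃ B : ℝ, ∀ κ u κ' u' x z a b, |T 0 κ u κ' u' x z a b| ≤ B) (hF : ∀ m, ∃ B : ℝ, ∀ κ u κ' u' x z a b, |F m κ u κ' u' x z a b| ≤ B)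
    (hrec : ∀ m, T (m + 1) = lin4 (c m) (unitK (sfStep Lc m) (smStep d Lc m) (GcombSh (d := d) Lc m)) Lc (T m) + F m)
    (P : (Fin (d + 1) → (Fin (d + 1) → ℤ) → Fin (d + 1) → (Fin (d + 1) → ℤ) → MKer (d + 1) (Fib d)) → Prop)
    (hxP : ∀ n, P (fun κ u κ' u' => rdiv (T n κ u κ' u'))) (hFP : ∀ n, P (fun κ u κ' u' => rdiv (F n κ u κ' u')))
    {GoodL GoodLS : (Fin (d + 1) → (Fin (d + 1) → ℤ) → Fin (d + 1) → (Fin (d + 1) → ℤ) → MKer (d + 1) (Fib d)) → ℝ → Prop} (δ δS : ℝ)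
    {k₀ : ℕ} (hk : 0 < k₀) {θ Cg A B CF gF M σ : ℝ} (hθ0 : 0 ≤ θ) (hθ1 : θ < 1) (hCg : 0 ≤ Cg) (hA : 0 ≤ A) (hB : 0 ≤ B) (hCF : 0 ≤ CF)
    (hgF : 0 ≤ gF) (hM : 0 ≤ M) (hσ : 0 ≤ σ)
    (H1 : ∀ n (W : (Fin (d + 1) → (Fin (d + 1) → ℤ) → Fin (d + 1) → (Fin (d + 1) → ℤ) → MKer (d + 1) (Fib d))) (C g : ℝ), P W →
      (∃ B : ℝ, ∀ κ u κ' u' x z a b, |W κ u κ' u' x z a b| ≤ B) → LocStencil₂ W C δ → GoodL W g →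
        LocStencil₂ (legChain (fun m => -(c m * ((Lc : ℝ) ^ (d + 1))⁻¹))
          (fun m => unitK (sfStep Lc m) (smStep d Lc m) (GcombSh (d := d) Lc m)) Lc n k₀
          (fun κ u κ' u' => bsumPow Lc k₀ (W κ u κ' u'))) (θ * C + Cg * g) δ)
    (Hw : ∀ p q (W : (Fin (d + 1) → (Fin (d + 1) → ℤ) → Fin (d + 1) → (Fin (d + 1) → ℤ) → MKer (d + 1) (Fib d))) (C g : ℝ), q < k₀ → P W →
      (∃ B : ℝ, ∀ κ u κ' u' x z a b, |W κ u κ' u' x z a b| ≤ B) → LocStencil₂ W C δS → GoodLS W g →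
        LocStencil₂ (legChain (fun m => -(c m * ((Lc : ℝ) ^ (d + 1))⁻¹))
          (fun m => unitK (sfStep Lc m) (smStep d Lc m) (GcombSh (d := d) Lc m)) Lc p q
          (fun κ u κ' u' => bsumPow Lc q (W κ u κ' u'))) (A * C + B * g) δ)
    (HS : ∀ n, LocStencil₂ (fun κ u κ' u' => rdiv (F n κ u κ' u')) CF δS) (HSL : ∀ n, GoodLS (fun κ u κ' u' => rdiv (F n κ u κ' u')) gF)
    (H0 : ∀ i, i < k₀ → LocStencil₂ (fun κ u κ' u' => rdiv (T i κ u κ' u')) M δ)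
    (H3 : ∀ n, GoodL (fun κ u κ' u' => rdiv (T n κ u κ' u')) σ) (n : ℕ) :
    LocStencil₂ (fun κ u κ' u' => rdiv (T n κ u κ' u')) (M + (Cg * σ + k₀ * (A * CF + B * gF)) * (1 - θ)⁻¹) δ := by
  have hK : ∀ m, ∃ δ C : ℝ, 0 < δ ∧ Decays (unitK (sfStep Lc m) (smStep d Lc m) (GcombSh (d := d) Lc m)) C δ :=
    fun m => decays_unitK_GcombSh (d := d) (Lc := Lc) m
  have hTb : ∀ m, ∃ B : ℝ, ∀ κ u κ' u' x z a b, |T m κ u κ' u' x z a b| ≤ B := by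
    intro m
    induction m with
    | zero => exact hT0
    | succ m ih =>
      obtain ⟨δ', C', hδ', hKm⟩ := hK m
      rw [hrec m]
      exact bdd₄_add (Lin4Additive.lin4_bdd hKm hδ' (c m) Lc ih) (hF m)
  have hstep : ∀ m κ u κ' u', rdiv (T (m + 1) κ u κ' u')
      = legStep (-(c m * ((Lc : ℝ) ^ (d + 1))⁻¹)) (unitK (sfStep Lc m) (smStep d Lc m) (GcombSh (d := d) Lc m))
          (unitK (sfStep Lc m) (smStep d Lc m) (GcombSh (d := d) Lc m)) Lc
          (fun κ u κ' u' => bsum Lc (rdiv (T m κ u κ' u'))) κ u κ' u' + rdiv (F m κ u κ' u') := by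
    intro m κ u κ' u'
    obtain ⟨B', hB'⟩ := hTb m
    rw [hrec m]
    exact rdiv_lin4_affine_GcombSh m (c m) hB' (F m) κ u κ' u'
  exact good_rdiv_tower_of_windows_slaved_mem (N := Lc) (kc := (fun m => -(c m * ((Lc : ℝ) ^ (d + 1))⁻¹)))
    (K := (fun m => unitK (sfStep Lc m) (smStep d Lc m) (GcombSh (d := d) Lc m))) hK hTb hF hstep P hxP hFP
    (Good := fun X C => LocStencil₂ X C δ) (GoodL := GoodL) (GoodS := fun X C => LocStencil₂ X C δS) (GoodLS := GoodLS)
    (fun _ _ _ _ hX hY => locStencil₂_add hX hY) (fun _ _ _ hCC hX => locStencil₂_mono hX hCC) (locStencil₂_zero (d := d) δ)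
    hk hθ0 hθ1 hCg hA hB hCF hgF hM hσ H1 Hw HS HSL H0 H3 n

/-- NOT IN PRINT; OUR BOOKKEEPING.  **THE SAME WITH (H0) ALSO DISCHARGED** — the display of record: (H1♮ on `P`)_δ ∧ (H1w on `P`)_{δS→δ} ∧ (HS)_{δS} ∧ (HSL) ∧ the initial
member's rows (Hx0)_{δS} `LocStencil₂ (rdiv ∘ T 0) C₀ δS`, (HxL0) `GoodLS (rdiv ∘ T 0) g₀` ∧ (H3) ⟹ `∀ n, LocStencil₂ (rdiv ∘ T n) (A·C₀ + B·g₀ + k₀·(A·C_F + B·g_F) +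
(Cg·σ + k₀·(A·C_F + B·g_F))·(1 − θ)⁻¹) δ`; every displayed rate is fixed BEFORE `k₀`.  The twin of MY (E) `LegTowerWindowSources.locStencil₂_rdiv_tower_of_windows_slaved_comb_mem₀`. -/
theorem locStencil₂_rdiv_tower_of_windows_slaved_combChart_mem₀ (c : ℕ → ℝ)
    {T F : ℕ → (Fin (d + 1) → (Fin (d + 1) → ℤ) → Fin (d + 1) → (Fin (d + 1) → ℤ) → MKer (d + 1) (Fib d))}
    (hT0 : ∃ B : ℝ, ∀ κ u κ' u' x z a b, |T 0 κ u κ' u' x z a b| ≤ B) (hF : ∀ m, ∃ B : ℝ, ∀ κ u κ' u' x z a b, |F m κ u κ' u' x z a b| ≤ B)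
    (hrec : ∀ m, T (m + 1) = lin4 (c m) (unitK (sfStep Lc m) (smStep d Lc m) (GcombSh (d := d) Lc m)) Lc (T m) + F m)
    (P : (Fin (d + 1) → (Fin (d + 1) → ℤ) → Fin (d + 1) → (Fin (d + 1) → ℤ) → MKer (d + 1) (Fib d)) → Prop)
    (hxP : ∀ n, P (fun κ u κ' u' => rdiv (T n κ u κ' u'))) (hFP : ∀ n, P (fun κ u κ' u' => rdiv (F n κ u κ' u')))
    {GoodL GoodLS : (Fin (d + 1) → (Fin (d + 1) → ℤ) → Fin (d + 1) → (Fin (d + 1) → ℤ) → MKer (d + 1) (Fib d)) → ℝ → Prop} (δ δS : ℝ)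
    {k₀ : ℕ} (hk : 0 < k₀) {θ Cg A B CF gF C₀ g₀ σ : ℝ} (hθ0 : 0 ≤ θ) (hθ1 : θ < 1) (hCg : 0 ≤ Cg) (hA : 0 ≤ A) (hB : 0 ≤ B) (hCF : 0 ≤ CF)
    (hgF : 0 ≤ gF) (hC₀ : 0 ≤ C₀) (hg₀ : 0 ≤ g₀) (hσ : 0 ≤ σ)
    (H1 : ∀ n (W : (Fin (d + 1) → (Fin (d + 1) → ℤ) → Fin (d + 1) → (Fin (d + 1) → ℤ) → MKer (d + 1) (Fib d))) (C g : ℝ), P W →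
      (∃ B : ℝ, ∀ κ u κ' u' x z a b, |W κ u κ' u' x z a b| ≤ B) → LocStencil₂ W C δ → GoodL W g →
        LocStencil₂ (legChain (fun m => -(c m * ((Lc : ℝ) ^ (d + 1))⁻¹))
          (fun m => unitK (sfStep Lc m) (smStep d Lc m) (GcombSh (d := d) Lc m)) Lc n k₀
          (fun κ u κ' u' => bsumPow Lc k₀ (W κ u κ' u'))) (θ * C + Cg * g) δ)
    (Hw : ∀ p q (W : (Fin (d + 1) → (Fin (d + 1) → ℤ) → Fin (d + 1) → (Fin (d + 1) → ℤ) → MKer (d + 1) (Fib d))) (C g : ℝ), q < k₀ → P W →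
      (∃ B : ℝ, ∀ κ u κ' u' x z a b, |W κ u κ' u' x z a b| ≤ B) → LocStencil₂ W C δS → GoodLS W g →
        LocStencil₂ (legChain (fun m => -(c m * ((Lc : ℝ) ^ (d + 1))⁻¹))
          (fun m => unitK (sfStep Lc m) (smStep d Lc m) (GcombSh (d := d) Lc m)) Lc p q
          (fun κ u κ' u' => bsumPow Lc q (W κ u κ' u'))) (A * C + B * g) δ)
    (HS : ∀ n, LocStencil₂ (fun κ u κ' u' => rdiv (F n κ u κ' u')) CF δS) (HSL : ∀ n, GoodLS (fun κ u κ' u' => rdiv (F n κ u κ' u')) gF)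
    (Hx0 : LocStencil₂ (fun κ u κ' u' => rdiv (T 0 κ u κ' u')) C₀ δS) (HxL0 : GoodLS (fun κ u κ' u' => rdiv (T 0 κ u κ' u')) g₀)
    (H3 : ∀ n, GoodL (fun κ u κ' u' => rdiv (T n κ u κ' u')) σ) (n : ℕ) :
    LocStencil₂ (fun κ u κ' u' => rdiv (T n κ u κ' u')) (A * C₀ + B * g₀ + k₀ * (A * CF + B * gF) + (Cg * σ + k₀ * (A * CF + B * gF)) * (1 - θ)⁻¹) δ := by
  have hK : ∀ m, ∃ δ C : ℝ, 0 < δ ∧ Decays (unitK (sfStep Lc m) (smStep d Lc m) (GcombSh (d := d) Lc m)) C δ :=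
    fun m => decays_unitK_GcombSh (d := d) (Lc := Lc) m
  have hTb : ∀ m, ∃ B : ℝ, ∀ κ u κ' u' x z a b, |T m κ u κ' u' x z a b| ≤ B := by
    intro m
    induction m with
    | zero => exact hT0
    | succ m ih =>
      obtain ⟨δ', C', hδ', hKm⟩ := hK m
      rw [hrec m]
      exact bdd₄_add (Lin4Additive.lin4_bdd hKm hδ' (c m) Lc ih) (hF m)
  have hstep : ∀ m κ u κ' u', rdiv (T (m + 1) κ u κ' u')
      = legStep (-(c m * ((Lc : ℝ) ^ (d + 1))⁻¹)) (unitK (sfStep Lc m) (smStep d Lc m) (GcombSh (d := d) Lc m))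
          (unitK (sfStep Lc m) (smStep d Lc m) (GcombSh (d := d) Lc m)) Lc
          (fun κ u κ' u' => bsum Lc (rdiv (T m κ u κ' u'))) κ u κ' u' + rdiv (F m κ u κ' u') := by
    intro m κ u κ' u'
    obtain ⟨B', hB'⟩ := hTb m
    rw [hrec m]
    exact rdiv_lin4_affine_GcombSh m (c m) hB' (F m) κ u κ' u'
  exact good_rdiv_tower_of_windows_slaved_mem₀ (N := Lc) (kc := (fun m => -(c m * ((Lc : ℝ) ^ (d + 1))⁻¹)))
    (K := (fun m => unitK (sfStep Lc m) (smStep d Lc m) (GcombSh (d := d) Lc m))) hK hTb hF hstep P hxP hFP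
    (Good := fun X C => LocStencil₂ X C δ) (GoodL := GoodL) (GoodS := fun X C => LocStencil₂ X C δS) (GoodLS := GoodLS)
    (fun _ _ _ _ hX hY => locStencil₂_add hX hY) (fun _ _ _ hCC hX => locStencil₂_mono hX hCC) (locStencil₂_zero (d := d) δ)
    hk hθ0 hθ1 hCg hA hB hCF hgF hC₀ hg₀ hσ H1 Hw HS HSL Hx0 HxL0 H3 n

end Comb

/-! ## §2 The comb-chart leg tower: the drift END at three rates with (H2d) discharged -/

section CombDrift

/-- NOT IN PRINT; OUR BOOKKEEPING.  **THE DRIFT TWIN FOR A COMB-CHART LEG TOWER, `LocStencil₂` CURRENCY AT THREE RATES, DIRECT MEMBERSHIP, (H2d) DISCHARGED**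
(`T (m+1) = lin4 (c m) G′♮_m Lc (T m) + F m`, `kc m = −(c m·(Lc^{d+1})⁻¹)`; members at rate `δ`, sources at rate `δS`, differences at rate `δD`):
`hDP` ∧ `hxP` ∧ `hKP` ∧ `hSP` ∧ (H1♮)_{δD} ∧ (HwD)_{δS → δD} ∧ (H1Δw)_{δ → δD} ∧ (Hx)_δ ∧ (H3) ∧ (HS′)_{δS} ∧ (HSL′) ∧ (H0d)_{δD} ∧ (H3d) ⟹
`∃ c′ ϑ, 0 ≤ c′ ∧ 0 < ϑ < 1 ∧ ∀ n, LocStencil₂ (rdiv ∘ T (n+1) − rdiv ∘ T n) (c′·ϑ^n) δD`.  The twin of MY (E)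
`LegTowerWindowDriftSources.locStencil₂_rdiv_towerDiff_of_windows_slaved_comb_mem`; the rows are DISPLAYED, not discharged. -/
theorem locStencil₂_rdiv_towerDiff_of_windows_slaved_combChart_mem (c : ℕ → ℝ)
    {T F : ℕ → (Fin (d + 1) → (Fin (d + 1) → ℤ) → Fin (d + 1) → (Fin (d + 1) → ℤ) → MKer (d + 1) (Fib d))}
    (hT0 : ∃ B : ℝ, ∀ κ u κ' u' x z a b, |T 0 κ u κ' u' x z a b| ≤ B) (hF : ∀ m, ∃ B : ℝ, ∀ κ u κ' u' x z a b, |F m κ u κ' u' x z a b| ≤ B)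
    (hrec : ∀ m, T (m + 1) = lin4 (c m) (unitK (sfStep Lc m) (smStep d Lc m) (GcombSh (d := d) Lc m)) Lc (T m) + F m)
    (P : (Fin (d + 1) → (Fin (d + 1) → ℤ) → Fin (d + 1) → (Fin (d + 1) → ℤ) → MKer (d + 1) (Fib d)) → Prop)
    (hDP : ∀ n, P ((fun κ u κ' u' => rdiv (T (n + 1) κ u κ' u')) - (fun κ u κ' u' => rdiv (T n κ u κ' u'))))
    (hxP : ∀ n, P (fun κ u κ' u' => rdiv (T n κ u κ' u')))
    (hKP : ∀ l, P (legStepB (fun m => -(c m * ((Lc : ℝ) ^ (d + 1))⁻¹))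
          (fun m => unitK (sfStep Lc m) (smStep d Lc m) (GcombSh (d := d) Lc m)) Lc (l + 1) (fun κ u κ' u' => rdiv (T l κ u κ' u'))
        - legStepB (fun m => -(c m * ((Lc : ℝ) ^ (d + 1))⁻¹))
          (fun m => unitK (sfStep Lc m) (smStep d Lc m) (GcombSh (d := d) Lc m)) Lc l (fun κ u κ' u' => rdiv (T l κ u κ' u'))))
    (hSP : ∀ l, P ((fun κ u κ' u' => rdiv (F (l + 1) κ u κ' u')) - (fun κ u κ' u' => rdiv (F l κ u κ' u'))))
    {GoodL GoodLS GoodLD : (Fin (d + 1) → (Fin (d + 1) → ℤ) → Fin (d + 1) → (Fin (d + 1) → ℤ) → MKer (d + 1) (Fib d)) → ℝ → Prop} (δ δS δD : ℝ)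
    {k₀ : ℕ} (hk : 0 < k₀) {θ Cg A B AΔ BΔ Cx σ CF' gF' ν M σd : ℝ} (hθ0 : 0 ≤ θ) (hθ1 : θ < 1) (hCg : 0 ≤ Cg) (hA : 0 ≤ A) (hB : 0 ≤ B)
    (hAΔ : 0 ≤ AΔ) (hBΔ : 0 ≤ BΔ) (hCx : 0 ≤ Cx) (hσ : 0 ≤ σ) (hCF' : 0 ≤ CF') (hgF' : 0 ≤ gF') (hν0 : 0 ≤ ν) (hν1 : ν < 1) (hM : 0 ≤ M) (hσd : 0 ≤ σd)
    (H1 : ∀ n (W : (Fin (d + 1) → (Fin (d + 1) → ℤ) → Fin (d + 1) → (Fin (d + 1) → ℤ) → MKer (d + 1) (Fib d))) (C g : ℝ), P W →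
      (∃ B : ℝ, ∀ κ u κ' u' x z a b, |W κ u κ' u' x z a b| ≤ B) → LocStencil₂ W C δD → GoodLD W g →
        LocStencil₂ (legChain (fun m => -(c m * ((Lc : ℝ) ^ (d + 1))⁻¹))
          (fun m => unitK (sfStep Lc m) (smStep d Lc m) (GcombSh (d := d) Lc m)) Lc n k₀
          (fun κ u κ' u' => bsumPow Lc k₀ (W κ u κ' u'))) (θ * C + Cg * g) δD)
    (HwD : ∀ p q (W : (Fin (d + 1) → (Fin (d + 1) → ℤ) → Fin (d + 1) → (Fin (d + 1) → ℤ) → MKer (d + 1) (Fib d))) (C g : ℝ), q < k₀ → P W →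
      (∃ B : ℝ, ∀ κ u κ' u' x z a b, |W κ u κ' u' x z a b| ≤ B) → LocStencil₂ W C δS → GoodLS W g →
        LocStencil₂ (legChain (fun m => -(c m * ((Lc : ℝ) ^ (d + 1))⁻¹))
          (fun m => unitK (sfStep Lc m) (smStep d Lc m) (GcombSh (d := d) Lc m)) Lc p q
          (fun κ u κ' u' => bsumPow Lc q (W κ u κ' u'))) (A * C + B * g) δD)
    (HΔw : ∀ l q (W : (Fin (d + 1) → (Fin (d + 1) → ℤ) → Fin (d + 1) → (Fin (d + 1) → ℤ) → MKer (d + 1) (Fib d))) (C g : ℝ), q < k₀ → P W →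
      (∃ B : ℝ, ∀ κ u κ' u' x z a b, |W κ u κ' u' x z a b| ≤ B) → LocStencil₂ W C δ → GoodL W g →
        LocStencil₂ (legChain (fun m => -(c m * ((Lc : ℝ) ^ (d + 1))⁻¹))
          (fun m => unitK (sfStep Lc m) (smStep d Lc m) (GcombSh (d := d) Lc m)) Lc (l + 2) q
          (fun κ u κ' u' => bsumPow Lc q ((legStepB (fun m => -(c m * ((Lc : ℝ) ^ (d + 1))⁻¹))
              (fun m => unitK (sfStep Lc m) (smStep d Lc m) (GcombSh (d := d) Lc m)) Lc (l + 1) W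
            - legStepB (fun m => -(c m * ((Lc : ℝ) ^ (d + 1))⁻¹))
              (fun m => unitK (sfStep Lc m) (smStep d Lc m) (GcombSh (d := d) Lc m)) Lc l W) κ u κ' u'))) ((AΔ * C + BΔ * g) * ν ^ l) δD)
    (Hx : ∀ l, LocStencil₂ (fun κ u κ' u' => rdiv (T l κ u κ' u')) Cx δ) (H3 : ∀ l, GoodL (fun κ u κ' u' => rdiv (T l κ u κ' u')) σ)
    (HS' : ∀ l, LocStencil₂ ((fun κ u κ' u' => rdiv (F (l + 1) κ u κ' u')) - (fun κ u κ' u' => rdiv (F l κ u κ' u'))) (CF' * ν ^ l) δS)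
    (HSL' : ∀ l, GoodLS ((fun κ u κ' u' => rdiv (F (l + 1) κ u κ' u')) - (fun κ u κ' u' => rdiv (F l κ u κ' u'))) (gF' * ν ^ l))
    (H0 : ∀ i, i < k₀ → LocStencil₂ ((fun κ u κ' u' => rdiv (T (i + 1) κ u κ' u')) - (fun κ u κ' u' => rdiv (T i κ u κ' u'))) M δD)
    (H3d : ∀ n, GoodLD ((fun κ u κ' u' => rdiv (T (n + 1) κ u κ' u')) - (fun κ u κ' u' => rdiv (T n κ u κ' u'))) (σd * ν ^ n)) :
    ∃ c' ϑ : ℝ, 0 ≤ c' ∧ 0 < ϑ ∧ ϑ < 1 ∧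
      ∀ n, LocStencil₂ ((fun κ u κ' u' => rdiv (T (n + 1) κ u κ' u')) - (fun κ u κ' u' => rdiv (T n κ u κ' u'))) (c' * ϑ ^ n) δD := by
  have hK : ∀ m, ∃ δ C : ℝ, 0 < δ ∧ Decays (unitK (sfStep Lc m) (smStep d Lc m) (GcombSh (d := d) Lc m)) C δ :=
    fun m => decays_unitK_GcombSh (d := d) (Lc := Lc) m
  have hTb : ∀ m, ∃ B : ℝ, ∀ κ u κ' u' x z a b, |T m κ u κ' u' x z a b| ≤ B := by
    intro m
    induction m with
    | zero => exact hT0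
    | succ m ih =>
      obtain ⟨δ', C', hδ', hKm⟩ := hK m
      rw [hrec m]
      exact bdd₄_add (Lin4Additive.lin4_bdd hKm hδ' (c m) Lc ih) (hF m)
  have hstep : ∀ m κ u κ' u', rdiv (T (m + 1) κ u κ' u')
      = legStep (-(c m * ((Lc : ℝ) ^ (d + 1))⁻¹)) (unitK (sfStep Lc m) (smStep d Lc m) (GcombSh (d := d) Lc m))
          (unitK (sfStep Lc m) (smStep d Lc m) (GcombSh (d := d) Lc m)) Lc
          (fun κ u κ' u' => bsum Lc (rdiv (T m κ u κ' u'))) κ u κ' u' + rdiv (F m κ u κ' u') := by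
    intro m κ u κ' u'
    obtain ⟨B', hB'⟩ := hTb m
    rw [hrec m]
    exact rdiv_lin4_affine_GcombSh m (c m) hB' (F m) κ u κ' u'
  exact good_rdiv_towerDiff_of_windows_slaved_mem (N := Lc) (kc := (fun m => -(c m * ((Lc : ℝ) ^ (d + 1))⁻¹)))
    (K := (fun m => unitK (sfStep Lc m) (smStep d Lc m) (GcombSh (d := d) Lc m))) hK hTb hF hstep P hDP hxP hKP hSP
    (Good := fun X C => LocStencil₂ X C δ) (GoodL := GoodL) (GoodS := fun X C => LocStencil₂ X C δS) (GoodLS := GoodLS)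
    (GoodD := fun X C => LocStencil₂ X C δD) (GoodLD := GoodLD)
    (fun _ _ _ _ hX hY => locStencil₂_add hX hY) (fun _ _ _ hCC hX => locStencil₂_mono hX hCC) (locStencil₂_zero (d := d) δD)
    hk hθ0 hθ1 hCg hA hB hAΔ hBΔ hCx hσ hCF' hgF' hν0 hν1 hM hσd H1 HwD HΔw Hx H3 HS' HSL' H0 H3d

end CombDrift

end Summit.QuantumFields.BalabanUV.Beta.GAN24.CombLegTowerWindowSources

end
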